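import Literature.MathematicalPhysics.QuantumFieldTheory.Balaban1983to89.B9CoReadingCoordsTranspose
import Literature.MathematicalPhysics.QuantumFieldTheory.Balaban1983to89.B9RWSums346SecondDiffGp
import Literature.MathematicalPhysics.QuantumFieldTheory.Balaban1983to89.B9PinMembersKLevelV1
import Literature.MathematicalPhysics.QuantumFieldTheory.Balaban1983to89.B7Prop2SpecialUnitary

/-!
# ∇\*_{U,μ} IS THE TRANSPOSE OF ∇_{U,μ}, PER DIRECTION, AT THE COORDINATE PINS OF THE `OpsY` INSTANCE

[B9] p. 391: *"∇\*_U … the adjoint of ∇_U with respect to natural L² scalar products for functions with values in N × N hermitian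
matrices"*; (3.8) p. 392 is the summation-by-parts identity behind it.  The N06 certificate at the `OpsY` letters of record
(`Summits/…/BalabanUVNodesN06AtOpsYNuOfRecordV6EPair*.lean`) displays, inside its second-order L² binders `h36H` ∕ `h36HA`, the
kinematic conjuncts

* `DirTranspose37 (𝔬 x) (𝔡 x) U`  — site sector (G′ walk, Theorem 3.7 side), and
* `DirTranspose310 (𝔬A x) (𝔡A x) U` — bond sector (G walk, Theorem 3.10 side),

i.e. `∀ μ, IsTransposePair ((𝔡 x).Dsd U μ) ((𝔡 x).Dd U μ)`, while it PINS the direction letters to def-Y's coordinate models: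
`(𝔡 x).Dd U = fun μ => (etaS x.toKIdx)⁻¹ • coordOpK (trBasis N) (fun _ => (cdSL x.toKIdx U μ).restrictScalars ℝ)` (and `Dsd` with
`cdsSL`), `(𝔡A x).Dd U = fun μ => coordOpK (trBasis N) (fun _ => cdBₗ x.toKIdx U μ)` (and `Dsd` with `cdsBₗ`).

This file INHABITS the two conjuncts from the pins alone, for `SU(N)`-valued (more generally unitary-valued) configurations:

* §1 (site sector) `isTransposePair_coordOpK_cdsSL_cdSL`: for a trace-orthonormal real basis `b` of `M_N(ℂ)` and ANY slot type `D`,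
  `IsTransposePair (coordOpK b (fun _ : D => ∇\*_{U,μ})) (coordOpK b (fun _ : D => ∇_{U,μ}))` — n06-d's dictionary lemma
  `B9CoReadingCoordsTranspose.isTransposePair_coordOpK_of_adjoint` fed with (3.8) on sites (`sum_trReForm_cdS`); the pin corollaries
  `dirTranspose37_of_pins` (with the `η⁻¹` scalar, `isTransposePair_smul`) and `dirTranspose37_of_pins'` (no scalar);
* §2 (bond sector) `isTransposePair_coordOpK_cdsB_cdB` from (3.8) on bonds (`sum_trReForm_cdB`); `dirTranspose310_of_pins`,
  `dirTranspose310_of_pins_smul`;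
* §3 the MEMBER forms at `x : MemberY …`, backgrounds `bg9Y (M_N(ℂ)) (SU(N)) x`, `cfg = id`, basis `trBasis N`, under the (3.35) class
  `Reg335 c α₀ U` (whose first clause is `U ∈ SU(N)` bondwise): `dirTranspose37_memberY`, `dirTranspose310_memberY`, and the family forms
  `dirTranspose37_of_record_pins` ∕ `dirTranspose310_of_record_pins` whose hypotheses are the certificate's binders `h𝔡d h𝔡s` ∕ `h𝔡Ad h𝔡As`
  verbatim — drop-in replacements for the two displayed conjuncts (a later edition may bind `h36H` ∕ `h36HA` WITHOUT them and rebuild them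
  inside the proof).

HONEST SCOPE: finite-dimensional linear algebra at the letters — (3.8) per direction read through the coordinate dictionary; nothing of [B9]'s
estimates (Theorems 3.7 ∕ 3.10, Corollary 3.6) is asserted; count-neutral; N06 is NOT discharged; nothing about the continuum limit, OS axioms,
a mass gap or the Clay problem.

[cite: Balaban1985BackgroundPropagators, p.391 (L² adjoints), (3.8) p.392, (3.35) p.396, (3.46) p.398]
[cite: Balaban1984PropagatorsII, (2.51) p.232]
-/

namespace Literature.MathematicalPhysics.QuantumFieldTheory.Balaban1983to89.Node00.OpsYDirTranspose

open scoped Matrix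
open scoped Matrix.Norms.L2Operator
open B6KLevelCensusIndexV1 (KIdx)
open B9Thm37Glue (IsTransposePair)
open B9Thm37GlueTorusCov (isTransposePair_smul)
open B9CoReadingCoords (coordOpK XBK cdBₗ cdsBₗ cdBₗ_apply cdsBₗ_apply)
open B9CoReadingCoordsS (XSK)
open B9CoReadingCoordsTranspose (isTransposePair_coordOpK_of_adjoint trReForm trReForm_apply trReForm_symm sum_trReForm_cdB
  sum_trReForm_cdS TrIdx trBasis trBasis_repr_eq_trace)
open B9Ineq349SiteComposite (cdSL cdsSL cdSL_apply cdsSL_apply)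
open B9Thm37Whole (Ops)
open B9Thm310Whole (Ops310)
open B9RWSums346SecondDiff (DirOps310 DirTranspose310)
open B9RWSums346SecondDiffGp (DirOps37 DirTranspose37)
open B9PinMembersKLevelV1 (MemberY geo9Y bg9Y)
open B7Prop2SpecialUnitary (specialUnitaryUnits specialUnitaryUnits_le_unitaryUnits)
open Node00 (SiteY FBondY CfgY cdS cdsS cdB cdsB etaS)

variable {κ : Type} [Fintype κ] [DecidableEq κ]
variable {N : ℕ} {d ℓ : ℕ} {hd : 1 ≤ d + 1} {hL : Odd (ℓ + 1) ∧ 1 < ℓ + 1} {b₀ b₁ : ℝ} (i : KIdx d ℓ hd hL b₀ b₁)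
  (b : Module.Basis κ ℝ (Matrix (Fin N) (Fin N) ℂ))

/-! ## §1 The SITE sector (G′ walk, Theorem 3.7 side): `cdsSL ∕ cdSL` -/

section Site

omit [DecidableEq κ] in
/-- ★ **PER DIRECTION, THE COORDINATE MODEL OF ∇\*_{U,μ} IS THE TRANSPOSE OF THAT OF ∇_{U,μ} (site sector)**: for a trace-orthonormal real basis `b`
(`repr_c v = Re tr((b c)ᴴ v)`), a unitary-valued configuration `U` and ANY slot type `D` (constant slices),
`IsTransposePair (coordOpK b (fun _ => ∇\*_{U,μ})) (coordOpK b (fun _ => ∇_{U,μ}))` — (3.8) on the site sector, direction by direction.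
[cite: Balaban1985BackgroundPropagators, p.391 (L² adjoints), (3.8) p.392; Balaban1984PropagatorsII, (2.51) p.232] -/
theorem isTransposePair_coordOpK_cdsSL_cdSL {D : Type} [Fintype D]
    (hb : ∀ (v : Matrix (Fin N) (Fin N) ℂ) (c : κ), b.repr v c = (Matrix.trace ((b c)ᴴ * v)).re)
    (U : CfgY (Matrix (Fin N) (Fin N) ℂ) i)
    (hU : ∀ μ x, ((U μ x : (Matrix (Fin N) (Fin N) ℂ)ˣ) : Matrix (Fin N) (Fin N) ℂ) ∈ unitary (Matrix (Fin N) (Fin N) ℂ))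
    (μ : Fin (d + 1)) :
    IsTransposePair (coordOpK b (fun _ : D => (cdsSL i U μ).restrictScalars ℝ)) (coordOpK b (fun _ : D => (cdSL i U μ).restrictScalars ℝ)) := by
  refine isTransposePair_coordOpK_of_adjoint b trReForm trReForm_symm (fun v c => by rw [hb, trReForm_apply]) _ _ fun ν Φ Ψ => ?_
  simp only [LinearMap.coe_restrictScalars, cdSL_apply, cdsSL_apply]
  -- `Σ Re tr(Ψ\* ∇\*Φ) = Σ Re tr((∇\*Φ)\* Ψ) = Σ Re tr(Φ\* ∇Ψ) = Σ Re tr((∇Ψ)\* Φ)`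
  calc ∑ x, trReForm (Ψ x) (cdsS i U μ Φ x) = ∑ x, trReForm (cdsS i U μ Φ x) (Ψ x) := Finset.sum_congr rfl fun x _ => trReForm_symm _ _
    _ = ∑ x, trReForm (Φ x) (cdS i U μ Ψ x) := (sum_trReForm_cdS i U hU μ Ψ Φ).symm
    _ = ∑ x, trReForm (cdS i U μ Ψ x) (Φ x) := Finset.sum_congr rfl fun x _ => trReForm_symm _ _

omit [DecidableEq κ] [Fintype κ] in
/-- ★ the site-sector transpose over the trace basis: NO basis hypothesis. [cite: Balaban1985BackgroundPropagators, (3.8) p.392] -/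
theorem isTransposePair_coordOpK_cdsSL_cdSL_trBasis {D : Type} [Fintype D] (U : CfgY (Matrix (Fin N) (Fin N) ℂ) i)
    (hU : ∀ μ x, ((U μ x : (Matrix (Fin N) (Fin N) ℂ)ˣ) : Matrix (Fin N) (Fin N) ℂ) ∈ unitary (Matrix (Fin N) (Fin N) ℂ))
    (μ : Fin (d + 1)) :
    IsTransposePair (coordOpK (trBasis N) (fun _ : D => (cdsSL i U μ).restrictScalars ℝ))
      (coordOpK (trBasis N) (fun _ : D => (cdSL i U μ).restrictScalars ℝ)) :=
  isTransposePair_coordOpK_cdsSL_cdSL i (trBasis N) (trBasis_repr_eq_trace N) U hU μ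

variable {g : B9.Geometry} {B : B9.Backgrounds} {Y ι : Type}

omit [DecidableEq κ] in
/-- ★★ **`DirTranspose37` AT THE PINS**: if the direction letters of a G′-walk datum over the site coordinate carrier `XSK κ i` are pinned to the
one-slot coordinate models `r • coordOpK b (fun _ => ∇_{U,μ})`, `r • coordOpK b (fun _ => ∇\*_{U,μ})` (the record: `r = η⁻¹`, `b = trBasis N`) at a
unitary-valued configuration, then ∇\*_{U,μ} is the transpose of ∇_{U,μ} for every μ — the displayed conjunct `DirTranspose37 𝔬 𝔡 U` of the N06
certificate's `h36H`. [cite: Balaban1985BackgroundPropagators, p.391 (L² adjoints), (3.8) p.392, (3.46) p.398] -/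
theorem dirTranspose37_of_pins (hb : ∀ (v : Matrix (Fin N) (Fin N) ℂ) (c : κ), b.repr v c = (Matrix.trace ((b c)ᴴ * v)).re)
    (𝔬 : Ops g B (XSK κ i) Y ι) (𝔡 : DirOps37 𝔬 (Fin (d + 1))) (cfg : B.Cfg → CfgY (Matrix (Fin N) (Fin N) ℂ) i) (U₁ : B.Cfg) (r : ℝ)
    (hDd : 𝔡.Dd U₁ = fun μ => r • coordOpK b (fun _ : Fin (d + 1) => (cdSL i (cfg U₁) μ).restrictScalars ℝ))
    (hDsd : 𝔡.Dsd U₁ = fun μ => r • coordOpK b (fun _ : Fin (d + 1) => (cdsSL i (cfg U₁) μ).restrictScalars ℝ))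
    (hU : ∀ μ x, ((cfg U₁ μ x : (Matrix (Fin N) (Fin N) ℂ)ˣ) : Matrix (Fin N) (Fin N) ℂ) ∈ unitary (Matrix (Fin N) (Fin N) ℂ)) :
    DirTranspose37 𝔬 𝔡 U₁ :=
  ⟨fun μ => by
    rw [hDd, hDsd]
    exact isTransposePair_smul (isTransposePair_coordOpK_cdsSL_cdSL i b hb (cfg U₁) hU μ) r⟩

omit [DecidableEq κ] in
/-- ★★ `DirTranspose37` at the pins, no scalar (`r = 1` written out). [cite: Balaban1985BackgroundPropagators, p.391, (3.8) p.392, (3.46) p.398] -/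
theorem dirTranspose37_of_pins' (hb : ∀ (v : Matrix (Fin N) (Fin N) ℂ) (c : κ), b.repr v c = (Matrix.trace ((b c)ᴴ * v)).re)
    (𝔬 : Ops g B (XSK κ i) Y ι) (𝔡 : DirOps37 𝔬 (Fin (d + 1))) (cfg : B.Cfg → CfgY (Matrix (Fin N) (Fin N) ℂ) i) (U₁ : B.Cfg)
    (hDd : 𝔡.Dd U₁ = fun μ => coordOpK b (fun _ : Fin (d + 1) => (cdSL i (cfg U₁) μ).restrictScalars ℝ))
    (hDsd : 𝔡.Dsd U₁ = fun μ => coordOpK b (fun _ : Fin (d + 1) => (cdsSL i (cfg U₁) μ).restrictScalars ℝ))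
    (hU : ∀ μ x, ((cfg U₁ μ x : (Matrix (Fin N) (Fin N) ℂ)ˣ) : Matrix (Fin N) (Fin N) ℂ) ∈ unitary (Matrix (Fin N) (Fin N) ℂ)) :
    DirTranspose37 𝔬 𝔡 U₁ :=
  ⟨fun μ => by
    rw [hDd, hDsd]
    exact isTransposePair_coordOpK_cdsSL_cdSL i b hb (cfg U₁) hU μ⟩

end Site

/-! ## §2 The BOND sector (G walk, Theorem 3.10 side): `cdsBₗ ∕ cdBₗ` -/

section Bond

omit [DecidableEq κ] in
/-- ★ **PER DIRECTION, THE COORDINATE MODEL OF ∇\*_{U,μ} IS THE TRANSPOSE OF THAT OF ∇_{U,μ} (bond sector)**: for a trace-orthonormal real basis `b`,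
a unitary-valued `U` and ANY slot type `D`, `IsTransposePair (coordOpK b (fun _ => cdsBₗ i U μ)) (coordOpK b (fun _ => cdBₗ i U μ))` — (3.8) on the
bond sector, direction by direction. [cite: Balaban1985BackgroundPropagators, p.391 (L² adjoints), (3.8) p.392; Balaban1984PropagatorsII, (2.51) p.232] -/
theorem isTransposePair_coordOpK_cdsB_cdB {D : Type} [Fintype D]
    (hb : ∀ (v : Matrix (Fin N) (Fin N) ℂ) (c : κ), b.repr v c = (Matrix.trace ((b c)ᴴ * v)).re)
    (U : CfgY (Matrix (Fin N) (Fin N) ℂ) i)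
    (hU : ∀ μ x, ((U μ x : (Matrix (Fin N) (Fin N) ℂ)ˣ) : Matrix (Fin N) (Fin N) ℂ) ∈ unitary (Matrix (Fin N) (Fin N) ℂ))
    (μ : Fin (d + 1)) :
    IsTransposePair (coordOpK b (fun _ : D => cdsBₗ i U μ)) (coordOpK b (fun _ : D => cdBₗ i U μ)) := by
  refine isTransposePair_coordOpK_of_adjoint b trReForm trReForm_symm (fun v c => by rw [hb, trReForm_apply]) _ _ fun ν Φ Ψ => ?_
  simp only [cdBₗ_apply, cdsBₗ_apply]
  calc ∑ x, trReForm (Ψ x) (cdsB i U μ Φ x) = ∑ x, trReForm (cdsB i U μ Φ x) (Ψ x) := Finset.sum_congr rfl fun x _ => trReForm_symm _ _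
    _ = ∑ x, trReForm (Φ x) (cdB i U μ Ψ x) := (sum_trReForm_cdB i U hU μ Ψ Φ).symm
    _ = ∑ x, trReForm (cdB i U μ Ψ x) (Φ x) := Finset.sum_congr rfl fun x _ => trReForm_symm _ _

omit [DecidableEq κ] [Fintype κ] in
/-- ★ the bond-sector transpose over the trace basis: NO basis hypothesis. [cite: Balaban1985BackgroundPropagators, (3.8) p.392] -/
theorem isTransposePair_coordOpK_cdsB_cdB_trBasis {D : Type} [Fintype D] (U : CfgY (Matrix (Fin N) (Fin N) ℂ) i)
    (hU : ∀ μ x, ((U μ x : (Matrix (Fin N) (Fin N) ℂ)ˣ) : Matrix (Fin N) (Fin N) ℂ) ∈ unitary (Matrix (Fin N) (Fin N) ℂ))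
    (μ : Fin (d + 1)) :
    IsTransposePair (coordOpK (trBasis N) (fun _ : D => cdsBₗ i U μ)) (coordOpK (trBasis N) (fun _ : D => cdBₗ i U μ)) :=
  isTransposePair_coordOpK_cdsB_cdB i (trBasis N) (trBasis_repr_eq_trace N) U hU μ

variable {g : B9.Geometry} {B : B9.Backgrounds} {Y ι A : Type}

omit [DecidableEq κ] in
/-- ★★ **`DirTranspose310` AT THE PINS**: if the direction letters of a G-walk datum over the bond coordinate carrier `XBK κ i` are pinned to the one-slot
coordinate models `coordOpK b (fun _ => cdBₗ i U μ)`, `coordOpK b (fun _ => cdsBₗ i U μ)` (the record: `b = trBasis N`) at a unitary-valued configuration,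
then ∇\*_{U,μ} is the transpose of ∇_{U,μ} for every μ — the displayed conjunct `DirTranspose310 𝔬A 𝔡A U` of the N06 certificate's `h36HA`.
[cite: Balaban1985BackgroundPropagators, p.391 (L² adjoints), (3.8) p.392, (3.46) p.398] -/
theorem dirTranspose310_of_pins (hb : ∀ (v : Matrix (Fin N) (Fin N) ℂ) (c : κ), b.repr v c = (Matrix.trace ((b c)ᴴ * v)).re)
    (𝔬 : Ops310 g B (XBK κ i) Y ι A) (𝔡 : DirOps310 𝔬 (Fin (d + 1))) (cfg : B.Cfg → CfgY (Matrix (Fin N) (Fin N) ℂ) i) (U₁ : B.Cfg)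
    (hDd : 𝔡.Dd U₁ = fun μ => coordOpK b (fun _ : Fin (d + 1) => cdBₗ i (cfg U₁) μ))
    (hDsd : 𝔡.Dsd U₁ = fun μ => coordOpK b (fun _ : Fin (d + 1) => cdsBₗ i (cfg U₁) μ))
    (hU : ∀ μ x, ((cfg U₁ μ x : (Matrix (Fin N) (Fin N) ℂ)ˣ) : Matrix (Fin N) (Fin N) ℂ) ∈ unitary (Matrix (Fin N) (Fin N) ℂ)) :
    DirTranspose310 𝔬 𝔡 U₁ :=
  ⟨fun μ => by
    rw [hDd, hDsd]
    exact isTransposePair_coordOpK_cdsB_cdB i b hb (cfg U₁) hU μ⟩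

omit [DecidableEq κ] in
/-- ★★ `DirTranspose310` at pins carrying a common scalar `r` (e.g. a lattice-spacing power). [cite: Balaban1985BackgroundPropagators, p.391, (3.8) p.392, (3.46) p.398] -/
theorem dirTranspose310_of_pins_smul (hb : ∀ (v : Matrix (Fin N) (Fin N) ℂ) (c : κ), b.repr v c = (Matrix.trace ((b c)ᴴ * v)).re)
    (𝔬 : Ops310 g B (XBK κ i) Y ι A) (𝔡 : DirOps310 𝔬 (Fin (d + 1))) (cfg : B.Cfg → CfgY (Matrix (Fin N) (Fin N) ℂ) i) (U₁ : B.Cfg) (r : ℝ)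
    (hDd : 𝔡.Dd U₁ = fun μ => r • coordOpK b (fun _ : Fin (d + 1) => cdBₗ i (cfg U₁) μ))
    (hDsd : 𝔡.Dsd U₁ = fun μ => r • coordOpK b (fun _ : Fin (d + 1) => cdsBₗ i (cfg U₁) μ))
    (hU : ∀ μ x, ((cfg U₁ μ x : (Matrix (Fin N) (Fin N) ℂ)ˣ) : Matrix (Fin N) (Fin N) ℂ) ∈ unitary (Matrix (Fin N) (Fin N) ℂ)) :
    DirTranspose310 𝔬 𝔡 U₁ :=
  ⟨fun μ => by
    rw [hDd, hDsd]
    exact isTransposePair_smul (isTransposePair_coordOpK_cdsB_cdB i b hb (cfg U₁) hU μ) r⟩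

end Bond

/-! ## §3 At the members of record: `bg9Y (M_N(ℂ)) (SU(N)) x`, `cfg = id`, the trace basis, the class (3.35) -/

section Member

variable {Mstar : ℕ}

/-- ★★ **`DirTranspose37 (𝔬 x) (𝔡 x) U` AT A MEMBER OF RECORD** from the pins `h𝔡d ∕ h𝔡s` of the N06 certificate and the (3.35) class of `U` (its first
clause `U ∈ SU(N)` bondwise makes `U` unitary-valued). [cite: Balaban1985BackgroundPropagators, p.391 (L² adjoints), (3.8) p.392, (3.35) p.396, (3.46) p.398] -/
theorem dirTranspose37_memberY (x : MemberY d ℓ hd hL b₀ b₁ Mstar) {Y ι : Type}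
    (𝔬 : Ops (geo9Y x) (bg9Y (Matrix (Fin N) (Fin N) ℂ) (specialUnitaryUnits (Fin N)) x) (XSK (TrIdx N) x.toKIdx) Y ι)
    (𝔡 : DirOps37 𝔬 (Fin (d + 1))) (U : (bg9Y (Matrix (Fin N) (Fin N) ℂ) (specialUnitaryUnits (Fin N)) x).Cfg) {c α₀ : ℝ}
    (hU : (bg9Y (Matrix (Fin N) (Fin N) ℂ) (specialUnitaryUnits (Fin N)) x).Reg335 c α₀ U)
    (hDd : 𝔡.Dd U = fun μ => (etaS x.toKIdx)⁻¹ • coordOpK (trBasis N) (fun _ : Fin (d + 1) => (cdSL x.toKIdx U μ).restrictScalars ℝ))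
    (hDsd : 𝔡.Dsd U = fun μ => (etaS x.toKIdx)⁻¹ • coordOpK (trBasis N) (fun _ : Fin (d + 1) => (cdsSL x.toKIdx U μ).restrictScalars ℝ)) :
    DirTranspose37 𝔬 𝔡 U :=
  dirTranspose37_of_pins x.toKIdx (trBasis N) (trBasis_repr_eq_trace N) 𝔬 𝔡 (fun U => U) U _ hDd hDsd
    fun μ z => specialUnitaryUnits_le_unitaryUnits (hU.1.1 μ z)

/-- ★★ **`DirTranspose310 (𝔬A x) (𝔡A x) U` AT A MEMBER OF RECORD** from the pins `h𝔡Ad ∕ h𝔡As` of the N06 certificate and the (3.35) class of `U`.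
[cite: Balaban1985BackgroundPropagators, p.391 (L² adjoints), (3.8) p.392, (3.35) p.396, (3.46) p.398] -/
theorem dirTranspose310_memberY (x : MemberY d ℓ hd hL b₀ b₁ Mstar) {Y ι A : Type}
    (𝔬 : Ops310 (geo9Y x) (bg9Y (Matrix (Fin N) (Fin N) ℂ) (specialUnitaryUnits (Fin N)) x) (XBK (TrIdx N) x.toKIdx) Y ι A)
    (𝔡 : DirOps310 𝔬 (Fin (d + 1))) (U : (bg9Y (Matrix (Fin N) (Fin N) ℂ) (specialUnitaryUnits (Fin N)) x).Cfg) {c α₀ : ℝ}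
    (hU : (bg9Y (Matrix (Fin N) (Fin N) ℂ) (specialUnitaryUnits (Fin N)) x).Reg335 c α₀ U)
    (hDd : 𝔡.Dd U = fun μ => coordOpK (trBasis N) (fun _ : Fin (d + 1) => cdBₗ x.toKIdx U μ))
    (hDsd : 𝔡.Dsd U = fun μ => coordOpK (trBasis N) (fun _ : Fin (d + 1) => cdsBₗ x.toKIdx U μ)) :
    DirTranspose310 𝔬 𝔡 U :=
  dirTranspose310_of_pins x.toKIdx (trBasis N) (trBasis_repr_eq_trace N) 𝔬 𝔡 (fun U => U) U hDd hDsd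
    fun μ z => specialUnitaryUnits_le_unitaryUnits (hU.1.1 μ z)

/-- ★★ **THE DISPLAYED CONJUNCT `DirTranspose37 (𝔬 x) (𝔡 x) U` OF `h36H` FROM THE CERTIFICATE'S OWN PIN BINDERS `h𝔡d h𝔡s`** (their text verbatim, as
hypotheses of this theorem) at every member and every configuration of the class (3.35). [cite: Balaban1985BackgroundPropagators, p.391, (3.8) p.392, (3.35) p.396, (3.46) p.398] -/
theorem dirTranspose37_of_record_pins {Y ι : MemberY d ℓ hd hL b₀ b₁ Mstar → Type}
    (𝔬 : ∀ x : MemberY d ℓ hd hL b₀ b₁ Mstar,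
      Ops (geo9Y x) (bg9Y (Matrix (Fin N) (Fin N) ℂ) (specialUnitaryUnits (Fin N)) x) (XSK (TrIdx N) x.toKIdx) (Y x) (ι x))
    (𝔡 : ∀ x : MemberY d ℓ hd hL b₀ b₁ Mstar, DirOps37 (𝔬 x) (Fin (d + 1)))
    (h𝔡d : ∀ (x : MemberY d ℓ hd hL b₀ b₁ Mstar) (U : (bg9Y (Matrix (Fin N) (Fin N) ℂ) (specialUnitaryUnits (Fin N)) x).Cfg),
      (𝔡 x).Dd U = fun μ => (etaS x.toKIdx)⁻¹ • coordOpK (trBasis N) (fun _ : Fin (d + 1) => (cdSL x.toKIdx U μ).restrictScalars ℝ))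
    (h𝔡s : ∀ (x : MemberY d ℓ hd hL b₀ b₁ Mstar) (U : (bg9Y (Matrix (Fin N) (Fin N) ℂ) (specialUnitaryUnits (Fin N)) x).Cfg),
      (𝔡 x).Dsd U = fun μ => (etaS x.toKIdx)⁻¹ • coordOpK (trBasis N) (fun _ : Fin (d + 1) => (cdsSL x.toKIdx U μ).restrictScalars ℝ))
    (x : MemberY d ℓ hd hL b₀ b₁ Mstar) (c α₀ : ℝ) (U : (bg9Y (Matrix (Fin N) (Fin N) ℂ) (specialUnitaryUnits (Fin N)) x).Cfg)
    (hU : (bg9Y (Matrix (Fin N) (Fin N) ℂ) (specialUnitaryUnits (Fin N)) x).Reg335 c α₀ U) :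
    DirTranspose37 (𝔬 x) (𝔡 x) U :=
  dirTranspose37_memberY x (𝔬 x) (𝔡 x) U hU (h𝔡d x U) (h𝔡s x U)

/-- ★★ **THE DISPLAYED CONJUNCT `DirTranspose310 (𝔬A x) (𝔡A x) U` OF `h36HA` FROM THE CERTIFICATE'S OWN PIN BINDERS `h𝔡Ad h𝔡As`** at every member and
every configuration of the class (3.35). [cite: Balaban1985BackgroundPropagators, p.391, (3.8) p.392, (3.35) p.396, (3.46) p.398] -/
theorem dirTranspose310_of_record_pins {Y ι A : MemberY d ℓ hd hL b₀ b₁ Mstar → Type}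
    (𝔬A : ∀ x : MemberY d ℓ hd hL b₀ b₁ Mstar,
      Ops310 (geo9Y x) (bg9Y (Matrix (Fin N) (Fin N) ℂ) (specialUnitaryUnits (Fin N)) x) (XBK (TrIdx N) x.toKIdx) (Y x) (ι x) (A x))
    (𝔡A : ∀ x : MemberY d ℓ hd hL b₀ b₁ Mstar, DirOps310 (𝔬A x) (Fin (d + 1)))
    (h𝔡Ad : ∀ (x : MemberY d ℓ hd hL b₀ b₁ Mstar) (U : (bg9Y (Matrix (Fin N) (Fin N) ℂ) (specialUnitaryUnits (Fin N)) x).Cfg),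
      (𝔡A x).Dd U = fun μ => coordOpK (trBasis N) (fun _ : Fin (d + 1) => cdBₗ x.toKIdx U μ))
    (h𝔡As : ∀ (x : MemberY d ℓ hd hL b₀ b₁ Mstar) (U : (bg9Y (Matrix (Fin N) (Fin N) ℂ) (specialUnitaryUnits (Fin N)) x).Cfg),
      (𝔡A x).Dsd U = fun μ => coordOpK (trBasis N) (fun _ : Fin (d + 1) => cdsBₗ x.toKIdx U μ))
    (x : MemberY d ℓ hd hL b₀ b₁ Mstar) (c α₀ : ℝ) (U : (bg9Y (Matrix (Fin N) (Fin N) ℂ) (specialUnitaryUnits (Fin N)) x).Cfg)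
    (hU : (bg9Y (Matrix (Fin N) (Fin N) ℂ) (specialUnitaryUnits (Fin N)) x).Reg335 c α₀ U) :
    DirTranspose310 (𝔬A x) (𝔡A x) U :=
  dirTranspose310_memberY x (𝔬A x) (𝔡A x) U hU (h𝔡Ad x U) (h𝔡As x U)

end Member

end Literature.MathematicalPhysics.QuantumFieldTheory.Balaban1983to89.Node00.OpsYDirTranspose
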